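/-
Copyright (c) 2026 the pub-hodgecm-mathlib formalisation cell (harness21).  Prover seat hodgecm-mathlib-K2E2-p12 (g2), Track B «K2-LIT», engine E2, unit CAPTURE,
socket #20a line lead, 2026-09-04.  KERNEL module: THEOREMS ONLY (no definition, no named fact, no `sorry`, no instance, no notation).
-/
import Summits.HodgeConjecture.HodgeConjecture.Theorems.K2E2CapArchPairHolCotLineCast       -- ★ §1 cast (this seat): `linePair_frame_line` over ★ H1′-final `linePair_frame_of_packaged`
import Summits.HodgeConjecture.HodgeConjecture.Theorems.K2E2CapArchPairFrameTransport      -- ★ H2 (K2E4-p11): `capArchPairHolCot_frameTransport`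
import Summits.HodgeConjecture.HodgeConjecture.Theorems.F0P2sThetaOccursInEngineGen         -- ★ the engine's preamble rows (junction `ĉ`, knob `ν`, (CC₀), `harm`∕`hdef`)
import Summits.HodgeConjecture.HodgeConjecture.Theorems.F0P2OccGenCotangentOfOccursIn        -- ★ packaging `cmFieldOf` ∕ `hermSpace3Of`
import Summits.HodgeConjecture.HodgeConjecture.Theorems.H413FinPairRepGramTransport           -- ★ `realDiagonal_lineVec_eq_TW`
import Literature.NumberTheory.Automorphic.Liu2021.Def411WeilCarriersFrameTransport          -- ★ `lineW_realDiagonal`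
import HarnessLib

set_option autoImplicit false
set_option linter.dupNamespace false

/-!
# K2 ∕ E2 «ThetaExhaustionByRigidity», unit CAPTURE, socket #20a «ARCH-PAIR-HOLCOT» — THE CANONICAL CASE «#20a-CAN»: the #20a letter for every
# frame `(L, ι, H, T)` whose embedding `ι` IS the canonical representative of its place, `(mk ι).embedding = ι`

Cell hodgecm-mathlib (D-0151), FLOOR 0, Track B «K2-LIT», engine E2, crux item H413 = stmt-HodgeConjecture-24833 (route `HCCMUnconditional`).  Socket #20a
`Capture.sig_K2E2CapArchPairHolCot` (bytes 3efc5e019e17f8df); line lead K2E2-p12 (g2).  ROAD b2 «BRIDGE»: #20a = «#20a-CAN» (THIS FILE) + «#20a-NONCAN» (H4,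
K2E2-p13, the orientation mirror, from «#20a-CAN»).  «#20a-CAN» = the #20a bytes with ONE extra hypothesis `(InfinitePlace.mk ι).embedding = ι →` after the
`2 ≤ [L⁺:ℚ]` arrow (interface of record, K2 bus 2026-09-04T00:15:46Z; text `K2/K2E2-p12/g2/ARCH-PAIR-HOLCOT-CAN.txt`).

PROOF.  ★ H2 `K2E2CapArchPairFrameTransport.capArchPairHolCot_frameTransport` reduces the letter (all frames `(e₁, dV, g, ιV)`) to ONE frame; we take the
PACKAGED frame `(ArchSideTerm.e₁, frameD V, frameG V)` of `V := hermSpace3Of L ι H T hT ‹hpos›` over `F := cmFieldOf L` (`K F = L`, `Hm V = H` by `rfl`).  There,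
§2 replays the engine's preamble (★ `F0P2sThetaOccursInEngineGen`: the admissible representative `e := a∕2δ`, the slot sign, the junction `ĉ` with Liu's twist
equation, the knob `ν`, the centre identity (CC₀), `harm`∕`hdef`) and feeds ★ H1′-final `K2E2CapArchPackagedHolCot.linePair_frame_of_packaged` through §1, the
cast from the model's line spelling `(realDiagonal (lineVec a), diagonal (lineVec a), chiSplitting)` to the letter's `(T_W a, J_W a, chiSplittingLine)` (★
`forall_line_of_forall_realDiagonal`'s `subst` technique + ★ `chiSplittingLine_realDiagonal` + ★ `thetaLift_congr_splitting` ∕ ★ `archWeilRep_congr_splitting`).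
`--supports stmt-HodgeConjecture-24833 --as helper`; THEOREMS ONLY; imports ★ only.  HONEST LABEL: HC_CM is proved only modulo the 7 printed citations (2 remaining
named inputs: hLiu418 = stmt-HodgeConjecture-24832, h413 = stmt-HodgeConjecture-24833) until rung 0 closes; this file discharges no printed citation and pays
no socket by itself (#20a needs «#20a-NONCAN» too).
References: [Liu2021] Camb. J. Math. 9 (2021) Def. 4.11–4.12, App. D §D.1 Steps 1–3, Lem. D.2; [GelbartRogawski1991] Invent. Math. 105 (1991) §3.1;
[BorelJacquet1979] PSPM 33.1 §4.1–4.2; [KonnoKonno2007] Kyushu J. Math. 61 (2007) Thm 5.4; [Weil1964] Acta Math. 111 (1964) n° 41.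
-/

noncomputable section


open NumberField hiding relNormOneIdeles relNormOneRat probHaarRelNormOneQuot
open MulAction NumberField.InfinitePlace NumberField.mixedEmbedding IsDedekindDomain
open _root_.MeasureTheory _root_.MeasureTheory.Measure
open scoped SchwartzMap TensorProduct Classical Matrix ComplexConjugate NNReal
open Literature.NumberTheory.Automorphic Literature.NumberTheory.Automorphic.UnitaryGroup Literature.NumberTheory.Weil1964
open Literature.NumberTheory.Weil1964.ThetaKernelDatum Literature.NumberTheory.Li1992
open Literature.Geometry.ComplexHyperbolic.BallModel (U21 x₀)
open Literature.AlgebraicGeometry.ShimuraVarieties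
open Literature.AlgebraicGeometry.Motives (CMType)
open Literature.NumberTheory.GelbartRogawski1991 Literature.NumberTheory.GelbartRogawski1991.UnitaryDualPair
open Literature.NumberTheory.GelbartRogawski1991.UnitaryDualPair.WeilCoinv (commute_comp_inl_comp_inr finPairToAdelic finPairRep)
open Literature.NumberTheory.Automorphic.Liu2021
open Literature.NumberTheory.Automorphic.Liu2021.Def411WeilCarriers (omegaAtLine rhoVAtLine Chi TW JW JW_eq isSymm_TW isUnit_det_TW lineChar locF)
open Literature.NumberTheory.Automorphic.Liu2021.Def411WeilCarriersDoubling
open Literature.NumberTheory.GaloisRepresentations (HeckeCharacter)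
open Literature.RepresentationTheory.HarrisKudlaSweet1996 (IsSplittingChar)
open Literature.RepresentationTheory.CompactGroups (charCM)
open Literature.MeasureTheory.Group
open HodgeCM HodgeCM.Adelic HodgeCM.PerL34 HodgeCM.Model HodgeCM.Model.ThetaSpace HodgeCM.Model.ArchSideTerm HodgeCM.Model.ThetaAdelicSide
open HodgeCM.Model.ThetaDistFin HodgeCM.Model.HypCensus HodgeCM.Model.LiuIndex HodgeCM.Model.TowerCarrier HodgeCM.Model.SupplyResidual
open HodgeCM.Model.SupplyResidual.WeilPairData (charInv charInv_apply)
open Literature.Analysis.SegalBargmann (binvPi)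
open Literature.AlgebraicGeometry.ShimuraVarieties (BallForms.isPullbackCocycle_cotangentCocycle BallForms.expP)
open Literature.AlgebraicGeometry.Liu2021 (IsAdmissibleElement)
open Summit.HodgeConjecture.CorCM Summit.HodgeConjecture.CorCM.Model Summit.HodgeConjecture.CorCM.Transposition
open Summit.HodgeConjecture.CorCM.Transposition.OmegaChiSplitting (hsChiD)
open Summit.HodgeConjecture.HodgeConjecture.Cruxes.H413.CohFormsCarriers
open Summit.HodgeConjecture.HodgeConjecture.Cruxes.H413.CuspCot
open Summit.HodgeConjecture.HodgeConjecture.Cruxes.H413.ThetaDistAtLine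
open Summit.HodgeConjecture.HodgeConjecture.Cruxes.H413.AdmissibleLine
open Summit.HodgeConjecture.HodgeConjecture.Cruxes.H413.ThetaNonvanishing
open Summit.HodgeConjecture.HodgeConjecture.Cruxes.H413.RallisTransport
open Summit.HodgeConjecture.HodgeConjecture.Cruxes.H413.ThetaJunction

open scoped ComplexOrder
open Literature.NumberTheory.Automorphic.UnitaryGroup.CotangentForms
open Literature.NumberTheory.Automorphic.Liu2021.Def411WeilCarriers
open Literature.NumberTheory.Automorphic.IdeleClassGroup
open Summit.HodgeConjecture.HodgeConjecture.Cruxes.H413.K2E2CapArchPackagedLineLift (thetaLift_congr_splitting)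
open Summit.HodgeConjecture.HodgeConjecture.Cruxes.H413.K2E2CapArchPairHolCotLineCast (linePair_frame_line)
open Summit.HodgeConjecture.HodgeConjecture.Cruxes.H413.F0P2OccGenCotangentOfOccursIn (cmFieldOf hermSpace3Of)
open Summit.HodgeConjecture.CorCM.Transposition.CentralTypeAtPin (hasCentralTypeAt_chiSplittingLine_toHeckeCharacter)
open Literature.RepresentationTheory.Liu2021 (isOscillatorChar_toHeckeCharacter_iff)
namespace Summit.HodgeConjecture.HodgeConjecture.Cruxes.H413.K2E2CapArchPairHolCotCanonical

/-! ## §1 The letter's tail at a packaged frame -/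

set_option synthInstance.maxHeartbeats 400000 in
set_option maxHeartbeats 16000000 in
/-- **THE LETTER'S TAIL AT A PACKAGED FRAME `(F, V)`** (variable `F : HodgeCM.CMField`, any `V`, `[L⁺:ℚ] ≥ 2`, canonical `ι₁`, any Sylvester frame `T`): the #20a
conjuncts from `μ` on, in the letter's spelling, at the frame `(ArchSideTerm.e₁, frameD V, frameG V)` — the engine's preamble (★ `F0P2sThetaOccursInEngineGen`
:233–298 at `Φ := Φ_μ`, `e := a∕2δ`) feeding ★ B2a `linePair_frame_line` at `(T_W a, J_W a, charCM χ̃_χ)`.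
[cite: Liu2021, App. D §D.1 Steps 1–3, Lem. D.2 (2); Def. 4.12] [cite: GelbartRogawski1991, §3.1 Prop. 3.1.1 p. 455; Remark p. 457 L4–13]
[cite: KonnoKonno2007, Thm 5.4] -/
theorem capArchPairHolCot_packaged (F : HodgeCM.CMField) {ι₁ : F →+* ℂ} (V : HodgeCM.HermSpace3 F ι₁)
    (h2 : 2 ≤ Module.finrank ℚ ↥(maximalRealSubfield F.K)) (hemb : (InfinitePlace.mk ι₁).embedding = ι₁) (T : GL (Fin 3) ℂ)
    (hT : (T : Matrix (Fin 3) (Fin 3) ℂ)ᴴ * (HodgeCM.HermSpace3.Hm V).map ι₁ * (T : Matrix (Fin 3) (Fin 3) ℂ) =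
      Literature.Geometry.ComplexHyperbolic.BallModel.J) :
    ∀ (μ : Literature.NumberTheory.Automorphic.IdeleClassGroup F.K →ₜ* Circle) (hμ : IdeleClassGroup.IsConjugateSymplectic F.K μ),
      IdeleClassGroup.HasWeight F.K μ 1 → ι₁ ∈ hμ.cmType.1 →
    ∀ (a : (↥(maximalRealSubfield F.K))ˣ) (χ : Chi ↥(maximalRealSubfield F.K) F.K (IsCMField.complexConj F.K)),
      IsAdmissibleElement F.K hμ.cmType.1 (algebraMap ↥(maximalRealSubfield F.K) F.K a * (2 * imagUnit F.K)⁻¹) →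
    ∀ (hρ : HasThetaMajorants fun (p : CMAdelic F.K (frameD V) × ↥(UnitaryGroup.adelic ↥(maximalRealSubfield F.K) F.K (IsCMField.complexConj F.K) 1 (JW ↥(maximalRealSubfield F.K) F.K a)))
        (Φ' : piSchwartzBruhat ↥(maximalRealSubfield F.K) (Fin 3)) =>
          pairRep ↥(maximalRealSubfield F.K) F.K (IsCMField.complexConj F.K) 3 1 e₁ (Matrix.diagonal (frameD V)) (JW ↥(maximalRealSubfield F.K) F.K a)
            (chiSplittingLine F.K e₁ (frameD V) (frameD_real V) (frameD_ne V) (IdeleClassGroup.toHeckeCharacter F.K μ) (IdeleClassGroup.isUnitary_toHeckeCharacter F.K μ)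
                ((Literature.RepresentationTheory.Liu2021.isOscillatorChar_toHeckeCharacter_iff μ).mpr hμ) (TW ↥(maximalRealSubfield F.K) a) (isUnit_det_TW ↥(maximalRealSubfield F.K) a)
                (JW ↥(maximalRealSubfield F.K) F.K a) (JW_eq ↥(maximalRealSubfield F.K) F.K a)) p Φ')
      [MeasurableSpace (↥(UnitaryGroup.adelic ↥(maximalRealSubfield F.K) F.K (IsCMField.complexConj F.K) 1 (JW ↥(maximalRealSubfield F.K) F.K a)) ⧸
          (UnitaryGroup.toAdelic ↥(maximalRealSubfield F.K) F.K (IsCMField.complexConj F.K) 1 (JW ↥(maximalRealSubfield F.K) F.K a)).range)] [BorelSpace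
          (↥(UnitaryGroup.adelic ↥(maximalRealSubfield F.K) F.K (IsCMField.complexConj F.K) 1 (JW ↥(maximalRealSubfield F.K) F.K a)) ⧸
          (UnitaryGroup.toAdelic ↥(maximalRealSubfield F.K) F.K (IsCMField.complexConj F.K) 1 (JW ↥(maximalRealSubfield F.K) F.K a)).range)]
      [CompactSpace (CMAdelic F.K (frameD V) ⧸ CMRat F.K (frameD V))] (μW : Measure (↥(UnitaryGroup.adelic ↥(maximalRealSubfield F.K) F.K (IsCMField.complexConj F.K) 1
          (JW ↥(maximalRealSubfield F.K) F.K a)) ⧸ (UnitaryGroup.toAdelic ↥(maximalRealSubfield F.K) F.K (IsCMField.complexConj F.K) 1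
          (JW ↥(maximalRealSubfield F.K) F.K a)).range)) [IsFiniteMeasure μW]
      [SMulInvariantMeasure ↥(UnitaryGroup.adelic ↥(maximalRealSubfield F.K) F.K (IsCMField.complexConj F.K) 1 (JW ↥(maximalRealSubfield F.K) F.K a))
          (↥(UnitaryGroup.adelic ↥(maximalRealSubfield F.K) F.K (IsCMField.complexConj F.K) 1 (JW ↥(maximalRealSubfield F.K) F.K a)) ⧸
          (UnitaryGroup.toAdelic ↥(maximalRealSubfield F.K) F.K (IsCMField.complexConj F.K) 1 (JW ↥(maximalRealSubfield F.K) F.K a)).range) μW] [μW.IsOpenPosMeasure],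
      ∃ (φ : Fin 2 → 𝓢(((Fin 3 × Fin 1) → mixedSpace ↥(maximalRealSubfield F.K)), ℂ)) (j₀ : Fin 2),
        (haveI := normal_range_toAdelic_JW F.K a
         ∀ Φf : FinSB ↥(maximalRealSubfield F.K) (Fin 3 × Fin 1),
          (fun (x : (adelicGroupData ↥(maximalRealSubfield F.K) F.K (IsCMField.complexConj F.K) 3 (HodgeCM.HermSpace3.Hm V)).Adelic) (j : Fin 2) =>
            (thetaKernelDatum ↥(maximalRealSubfield F.K) F.K (IsCMField.complexConj F.K) 3 1 e₁ (Matrix.diagonal (frameD V)) (JW ↥(maximalRealSubfield F.K) F.K a)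
                (complexConj_imagUnit F.K) (imagUnit_ne_zero F.K) (imagUnit_mul_self F.K) (realDiagonal_isSymm F.K (frameD V) (frameD_real V)) (isSymm_TW ↥(maximalRealSubfield F.K) a)
                (isUnit_det_realDiagonal F.K (frameD V) (frameD_real V) (frameD_ne V)) (isUnit_det_TW ↥(maximalRealSubfield F.K) a) (realDiagonal_map F.K (frameD V) (frameD_real V)).symm
                (JW_eq ↥(maximalRealSubfield F.K) F.K a)
                (chiSplittingLine F.K e₁ (frameD V) (frameD_real V) (frameD_ne V) (IdeleClassGroup.toHeckeCharacter F.K μ) (IdeleClassGroup.isUnitary_toHeckeCharacter F.K μ)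
                    ((Literature.RepresentationTheory.Liu2021.isOscillatorChar_toHeckeCharacter_iff μ).mpr hμ) (TW ↥(maximalRealSubfield F.K) a)
                    (isUnit_det_TW ↥(maximalRealSubfield F.K) a) (JW ↥(maximalRealSubfield F.K) F.K a) (JW_eq ↥(maximalRealSubfield F.K) F.K a))
                (isCompatible_chiSplittingLine F.K e₁ (frameD V) (frameD_real V) (frameD_ne V) (IdeleClassGroup.toHeckeCharacter F.K μ) (IdeleClassGroup.isUnitary_toHeckeCharacter F.K μ)
                    ((Literature.RepresentationTheory.Liu2021.isOscillatorChar_toHeckeCharacter_iff μ).mpr hμ) (TW ↥(maximalRealSubfield F.K) a) (isSymm_TW ↥(maximalRealSubfield F.K) a)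
                    (isUnit_det_TW ↥(maximalRealSubfield F.K) a) (JW ↥(maximalRealSubfield F.K) F.K a) (JW_eq ↥(maximalRealSubfield F.K) F.K a))
                hρ Set.univ (fun _ _ _ => Set.mem_univ _)).thetaLiftFun μW
              (piSBReindex ↥(maximalRealSubfield F.K) e₁ (piSchwartzBruhatEquiv ↥(maximalRealSubfield F.K) (Fin 3 × Fin 1) (φ j ⊗ₜ[ℂ] Φf)))
              (charCM (chiQuot ↥(maximalRealSubfield F.K) F.K (IsCMField.complexConj F.K) (Algebra.IsQuadraticExtension.finrank_eq_two _ F.K) (IsCMField.complexConj_ne_one (K := F.K)) a χ))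
              ((cmAdelicFrameTransport F.K 3 (HodgeCM.HermSpace3.Hm V) (frameD V) (frameG V) (frame_congr V)) x)) ∈
            CotangentForms.holCotForms ↥(maximalRealSubfield F.K) F.K (IsCMField.complexConj F.K) 3 (HodgeCM.HermSpace3.Hm V) (CotangentForms.cmArchSection F.K ι₁
                (HodgeCM.HermSpace3.Hm V) T hT) (CotangentForms.cmCompactFactor F.K ι₁ (HodgeCM.HermSpace3.Hm V) T hT)) ∧
        schwartzReindexCLM ↥(maximalRealSubfield F.K) e₁ (φ j₀) ≠ 0 ∧
        ∀ a' : UnitaryGroup.arch ↥(maximalRealSubfield F.K) F.K (IsCMField.complexConj F.K) 1 (JW ↥(maximalRealSubfield F.K) F.K a),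
          (HodgeCM.Model.HypCensus.archWeilRep ↥(maximalRealSubfield F.K) F.K (IsCMField.complexConj F.K) 3 1 (Matrix.diagonal (frameD V)) (JW ↥(maximalRealSubfield F.K) F.K a)
              (complexConj_imagUnit F.K) (imagUnit_ne_zero F.K) (imagUnit_mul_self F.K) (realDiagonal_isSymm F.K (frameD V) (frameD_real V)) (isSymm_TW ↥(maximalRealSubfield F.K) a)
              (isUnit_det_realDiagonal F.K (frameD V) (frameD_real V) (frameD_ne V)) (isUnit_det_TW ↥(maximalRealSubfield F.K) a) (realDiagonal_map F.K (frameD V) (frameD_real V)).symm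
              (JW_eq ↥(maximalRealSubfield F.K) F.K a) e₁ (chiSplittingLine F.K e₁ (frameD V) (frameD_real V) (frameD_ne V) (IdeleClassGroup.toHeckeCharacter F.K μ)
              (IdeleClassGroup.isUnitary_toHeckeCharacter F.K μ) ((Literature.RepresentationTheory.Liu2021.isOscillatorChar_toHeckeCharacter_iff μ).mpr hμ)
              (TW ↥(maximalRealSubfield F.K) a) (isUnit_det_TW ↥(maximalRealSubfield F.K) a) (JW ↥(maximalRealSubfield F.K) F.K a) (JW_eq ↥(maximalRealSubfield F.K) F.K a))
              (ThetaNonvanishing.proj_apply_eq_toSp ↥(maximalRealSubfield F.K) F.K (IsCMField.complexConj F.K) 3 1 e₁ (Matrix.diagonal (frameD V)) (JW ↥(maximalRealSubfield F.K) F.K a)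
              (complexConj_imagUnit F.K) (imagUnit_ne_zero F.K) (imagUnit_mul_self F.K) (realDiagonal_isSymm F.K (frameD V) (frameD_real V)) (isSymm_TW ↥(maximalRealSubfield F.K) a)
              (isUnit_det_realDiagonal F.K (frameD V) (frameD_real V) (frameD_ne V)) (isUnit_det_TW ↥(maximalRealSubfield F.K) a) (realDiagonal_map F.K (frameD V) (frameD_real V)).symm
              (JW_eq ↥(maximalRealSubfield F.K) F.K a) (isCompatible_chiSplittingLine F.K e₁ (frameD V) (frameD_real V) (frameD_ne V) (IdeleClassGroup.toHeckeCharacter F.K μ)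
              (IdeleClassGroup.isUnitary_toHeckeCharacter F.K μ) ((Literature.RepresentationTheory.Liu2021.isOscillatorChar_toHeckeCharacter_iff μ).mpr hμ)
              (TW ↥(maximalRealSubfield F.K) a) (isSymm_TW ↥(maximalRealSubfield F.K) a) (isUnit_det_TW ↥(maximalRealSubfield F.K) a) (JW ↥(maximalRealSubfield F.K) F.K a)
              (JW_eq ↥(maximalRealSubfield F.K) F.K a))))
              (1, a') (schwartzReindexCLM ↥(maximalRealSubfield F.K) e₁ (φ j₀)) =
            schwartzReindexCLM ↥(maximalRealSubfield F.K) e₁ (φ j₀) := by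
  intro μ hμ hw hι a χ he hρ _ _ _ μW _ _ _
  -- `[L:ℚ] = 2[L⁺:ℚ] ≥ 4`, anisotropy of the frame
  have h4 : 4 ≤ Module.finrank ℚ F.K := by
    have h := Module.finrank_mul_finrank ℚ ↥(maximalRealSubfield F.K) F.K
    rw [Algebra.IsQuadraticExtension.finrank_eq_two ↥(maximalRealSubfield F.K) F.K] at h
    omega
  have hV : IsAnisotropic F (HodgeCM.HermSpace3.Hm V) :=
    (HodgeCM.HermSpace3.isAnisotropic_iff_finrank_ne_two V).2 (by show Module.finrank ℚ F.K ≠ 2; omega)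
  -- the admissible representative `e := a ∕ 2δ` of the line
  letI e : F.K := algebraMap ↥(maximalRealSubfield F.K) F.K a * (2 * imagUnit F.K)⁻¹
  have hae : (a : F.K) = e * (2 * imagUnit F.K) := by
    show (a : F.K) = algebraMap ↥(maximalRealSubfield F.K) F.K a * (2 * imagUnit F.K)⁻¹ * (2 * imagUnit F.K)
    rw [mul_assoc, inv_mul_cancel₀ (mul_ne_zero two_ne_zero (imagUnit_ne_zero F.K)), mul_one]; rfl
  haveI := normal_range_toAdelic_JW F.K a
  -- THE ENGINE'S PREAMBLE (★ `F0P2sThetaOccursInEngineGen.exists_holTheta_atFrame_of_chiN`, l. 233–298, at `Φ := Φ_μ`)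
  -- the line scalar `a`, the anisotropy, the canonical embedding, the slot sign
  have ha : IsCMField.complexConj F.K (a : F.K) = (a : F.K) := complexConj_lineVec_coe F.K a 0
  have ha0 : (a : F.K) ≠ 0 := lineVec_coe_ne_zero F.K a 0
  have hΦt : ∀ φ : F.K →+* ℂ, φ ∈ hμ.cmType.1 ↔ 0 < (φ (imagUnit F.K * (a : F.K))).im := fun φ => by
    rw [hae]; exact IsAdmissibleElement.mem_iff_im_pos hμ.cmType he (complexConj_imagUnit _) (imagUnit_ne_zero _) φ
  have hmem : (InfinitePlace.mk ι₁).embedding ∈ hμ.cmType.1 := by rw [hemb]; exact hι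
  have hpos : 0 < cmXW F.K (frameD V) (lineVec F.K (dW (cDiag hμ.cmType ι₁ (a : F.K) ha ha0).D 0)) (fun _ => dW_real (cDiag hμ.cmType ι₁ (a : F.K) ha ha0).D 0) ι₁ (cmPlace
      F.K ι₁) 0 :=
    (cmXW_pos_iff_of_eq V hae (fun _ => ha) (fun _ => complexConj_lineScalar (complexConj_imagUnit F.K) he.2.1)).2
      (cmXW_cmPlace_admissibleLine_pos_of_mem V hμ.cmType he hmem)
  -- (J) the junction: `ĉ`, `Ψ`
  obtain ⟨ĉ, hĉ, hĉV, hĉW, hĉc, Ψ, -, hΨlaw⟩ := exists_coinv_equiv_TW_splittingOf_adelic F.K e₁ (frameD V) (frameD_real V) (frameD_ne V)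
    (Literature.NumberTheory.Automorphic.IdeleClassGroup.toHeckeCharacter F.K μ) (Literature.NumberTheory.Automorphic.IdeleClassGroup.isUnitary_toHeckeCharacter F.K μ)
        ((Literature.RepresentationTheory.Liu2021.isOscillatorChar_toHeckeCharacter_iff μ).mpr hμ) a
        (isSymm_TW _ a) (isUnit_det_TW _ a) (JW_eq _ _ a)
    (lineChar (↥(maximalRealSubfield F.K)) F.K (IsCMField.complexConj F.K) a χ.1) (compat_line₀ V hμ.cmType ι₁ (a : F.K) ha ha0)
  -- (K) the knob `ν := χ₀(·,1) · (ĉ ∘ ι_V)⁻¹`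
  have hκ : ∀ γU ∈ CMRat F.K (frameD V), (ĉ.comp (UnitaryGroup.adelicInl (↥(maximalRealSubfield F.K)) F.K (IsCMField.complexConj F.K) 3 1 (Matrix.diagonal (frameD V)) (Matrix.diagonal
      (lineVec F.K (a : F.K))))) γU = 1 := fun γU hγU => hĉV γU hγU
  have hκc : Continuous fun v => (((ĉ.comp (UnitaryGroup.adelicInl (↥(maximalRealSubfield F.K)) F.K (IsCMField.complexConj F.K) 3 1 (Matrix.diagonal (frameD V)) (Matrix.diagonal
      (lineVec F.K (a : F.K))))) v : ℂˣ) : ℂ) :=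
    Units.continuous_val.comp (hĉc.comp (UnitaryGroup.continuous_adelicInl _ _ _ _ _ _ _))
  have hν := knobNu_eq_one_of_rat V (cDiag hμ.cmType ι₁ (a : F.K) ha ha0) (compat_plane V hμ.cmType ι₁ (a : F.K) ha ha0) (compat_line₀ V hμ.cmType ι₁ (a : F.K) ha ha0)
      (compat_line₁ V hμ.cmType ι₁ (a : F.K) ha ha0) (ĉ.comp (UnitaryGroup.adelicInl (↥(maximalRealSubfield F.K)) F.K (IsCMField.complexConj F.K) 3 1 (Matrix.diagonal (frameD V))
      (Matrix.diagonal (lineVec F.K (a : F.K))))) hκ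
  have hνc := continuous_knobNu V (cDiag hμ.cmType ι₁ (a : F.K) ha ha0) (compat_plane V hμ.cmType ι₁ (a : F.K) ha ha0) (compat_line₀ V hμ.cmType ι₁ (a : F.K) ha ha0)
      (compat_line₁ V hμ.cmType ι₁ (a : F.K) ha ha0) (ĉ.comp (UnitaryGroup.adelicInl (↥(maximalRealSubfield F.K)) F.K (IsCMField.complexConj F.K) 3 1 (Matrix.diagonal (frameD V))
      (Matrix.diagonal (lineVec F.K (a : F.K))))) hκc (h₁W_cDiag hμ.cmType ι₁ (a : F.K) ha ha0)
  -- (A) the centre identity (CC₀) for `κ := ĉ ∘ ι_V` from the central type of `s_μ` and the twist equation at the centre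
  have hct : HasCentralTypeAt V ⟨(a : F.K), ha, ha0⟩ (chiSplitting F.K e₁ (frameD V) (frameD_real V) (frameD_ne V) (lineVec F.K (a : F.K))
      (complexConj_lineVec_coe F.K a) (lineVec_coe_ne_zero F.K a) (Literature.NumberTheory.Automorphic.IdeleClassGroup.toHeckeCharacter F.K μ)
          (Literature.NumberTheory.Automorphic.IdeleClassGroup.isUnitary_toHeckeCharacter F.K μ)
      ((Literature.RepresentationTheory.Liu2021.isOscillatorChar_toHeckeCharacter_iff μ).mpr hμ)) (-(Pi.single (cmPlaceOver F.K (HypCensus.cmPlace F.K ι₁)).1 1)) := by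
    have h1 := hasCentralTypeAt_chiSplittingLine_toHeckeCharacter V ⟨(a : F.K), ha, ha0⟩ μ hμ hw
      (Φ := hμ.cmType) hμ.hasCMType_cmType hΦt
    rw [if_pos hmem, chiSplittingLine_realDiagonal] at h1
    rw [cmPlaceOver_eq_mk F.K (HypCensus.cmPlace F.K ι₁) ι₁ rfl]
    exact h1
  have hCC : ∀ t' : ↥(Literature.NumberTheory.Automorphic.relNormOneInfUnits (↥(maximalRealSubfield F.K)) F.K),
      ((lineCharV_zero V (cDiag hμ.cmType ι₁ (a : F.K) ha ha0).D (compat_plane V hμ.cmType ι₁ (a : F.K) ha ha0) (compat_line₀ V hμ.cmType ι₁ (a : F.K)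
          ha ha0) (compat_line₁ V hμ.cmType ι₁ (a : F.K) ha ha0) (etaT₀ V (cDiag hμ.cmType ι₁ (a : F.K) ha ha0).D (1 : CMAdelic F.K (frameD V) × CMAdelic F.K (dW (cDiag hμ.cmType ι₁
          (a : F.K) ha ha0).D) →* ℂˣ) ((cmLineChar₀ F.K finProdFinEquiv e₁ (frameD V) (frameD_real V) (frameD_ne V) (dW (cDiag hμ.cmType ι₁ (a : F.K) ha ha0).D) (dW_real
              (cDiag hμ.cmType ι₁ (a : F.K) ha ha0).D) (dW_ne (cDiag hμ.cmType ι₁ (a : F.K) ha ha0).D) (compat_plane V hμ.cmType ι₁ (a : F.K) ha ha0) (compat_line₀ V hμ.cmType ι₁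
          (a : F.K) ha ha0) (compat_line₁ V hμ.cmType ι₁ (a : F.K) ha ha0)).comp (MonoidHom.inl _ _) * (ĉ.comp (UnitaryGroup.adelicInl (↥(maximalRealSubfield F.K)) F.K
          (IsCMField.complexConj F.K) 3 1 (Matrix.diagonal (frameD V)) (Matrix.diagonal (lineVec F.K (a : F.K)))))⁻¹)) (CMCenter F.K (frameD V) (infUnitToOne F.K t')) : ℂˣ) : ℂ) *
        lineC V (a : F.K) ha ha0 (compat_line₀ V hμ.cmType ι₁ (a : F.K) ha ha0) t' = 1 := fun t' => by
    rw [ThetaDistAtLine.lineCharV_zero_etaT₀_one_knobNu]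
    refine CC_of_hasCentralTypeAt_of_center_smul V ⟨(a : F.K), ha, ha0⟩ (compat_line₀ V hμ.cmType ι₁ (a : F.K) ha ha0) (ĉ.comp (UnitaryGroup.adelicInl (↥(maximalRealSubfield F.K))
        F.K (IsCMField.complexConj F.K) 3 1 (Matrix.diagonal (frameD V)) (Matrix.diagonal (lineVec F.K (a : F.K))))) _ hct (fun t'' x₀' Nl => ?_) t'
    rw [hĉ, UnitaryDualPair.WeilCoinv.pairRep_twist_apply, map_one, mul_one]
    rfl
  have harm := harm_cDiag_of_CC V hμ.cmType ι₁ (a : F.K) ha ha0 (1 : CMAdelic F.K (frameD V) × CMAdelic F.K (dW (cDiag hμ.cmType ι₁ (a : F.K) ha ha0).D) →* ℂˣ)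
      (continuous_one_val V (cDiag hμ.cmType ι₁ (a : F.K) ha ha0)) ((cmLineChar₀ F.K finProdFinEquiv e₁ (frameD V) (frameD_real V) (frameD_ne V) (dW (cDiag hμ.cmType ι₁ (a : F.K) ha ha0).D)
      (dW_real (cDiag hμ.cmType ι₁ (a : F.K) ha ha0).D) (dW_ne (cDiag hμ.cmType ι₁ (a : F.K) ha ha0).D) (compat_plane V hμ.cmType ι₁ (a : F.K) ha ha0)
      (compat_line₀ V hμ.cmType ι₁ (a : F.K) ha ha0) (compat_line₁ V hμ.cmType ι₁ (a : F.K) ha ha0)).comp (MonoidHom.inl _ _) * (ĉ.comp (UnitaryGroup.adelicInl (↥(maximalRealSubfield F.K))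
      F.K (IsCMField.complexConj F.K) 3 1 (Matrix.diagonal (frameD V)) (Matrix.diagonal (lineVec F.K (a : F.K)))))⁻¹) hνc hpos hemb hCC
  have hdef := hdef_cDiag_of_CC V hμ.cmType ι₁ (a : F.K) ha ha0 (1 : CMAdelic F.K (frameD V) × CMAdelic F.K (dW (cDiag hμ.cmType ι₁ (a : F.K) ha ha0).D) →* ℂˣ)
      (continuous_one_val V (cDiag hμ.cmType ι₁ (a : F.K) ha ha0)) ((cmLineChar₀ F.K finProdFinEquiv e₁ (frameD V) (frameD_real V) (frameD_ne V) (dW (cDiag hμ.cmType ι₁ (a : F.K) ha ha0).D)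
      (dW_real (cDiag hμ.cmType ι₁ (a : F.K) ha ha0).D) (dW_ne (cDiag hμ.cmType ι₁ (a : F.K) ha ha0).D) (compat_plane V hμ.cmType ι₁ (a : F.K) ha ha0)
      (compat_line₀ V hμ.cmType ι₁ (a : F.K) ha ha0) (compat_line₁ V hμ.cmType ι₁ (a : F.K) ha ha0)).comp (MonoidHom.inl _ _) * (ĉ.comp (UnitaryGroup.adelicInl (↥(maximalRealSubfield F.K))
      F.K (IsCMField.complexConj F.K) 3 1 (Matrix.diagonal (frameD V)) (Matrix.diagonal (lineVec F.K (a : F.K)))))⁻¹) hνc hV hpos hCC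
  -- ★ B2a at the letter's line `(T_W a, J_W a)` and weight `charCM χ̃_χ`
  exact linePair_frame_line F V h4 hμ.cmType μ hμ hw hmem χ e a he hae hV ha ha0 hpos ĉ hĉ hĉV hĉW hĉc hν hνc
    (archLineInputAt V hμ.cmType ι₁ (a : F.K) ha ha0 (1 : CMAdelic F.K (frameD V) × CMAdelic F.K (dW (cDiag hμ.cmType ι₁ (a : F.K) ha ha0).D) →* ℂˣ)
      (continuous_etaInf_of_continuous V (1 : CMAdelic F.K (frameD V) × CMAdelic F.K (dW (cDiag hμ.cmType ι₁ (a : F.K) ha ha0).D) →* ℂˣ)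
        (continuous_one_val V (cDiag hμ.cmType ι₁ (a : F.K) ha ha0))) _)
    harm hdef hemb T hT (TW ↥(maximalRealSubfield F.K) a) (isSymm_TW ↥(maximalRealSubfield F.K) a) (isUnit_det_TW ↥(maximalRealSubfield F.K) a) (JW ↥(maximalRealSubfield F.K) F.K a)
        (JW_eq ↥(maximalRealSubfield F.K) F.K a)
    (by rw [← realDiagonal_lineVec_eq_TW F.K a, lineW_realDiagonal]) hρ μW
    (charCM (chiQuot ↥(maximalRealSubfield F.K) F.K (IsCMField.complexConj F.K) (Algebra.IsQuadraticExtension.finrank_eq_two _ F.K) (IsCMField.complexConj_ne_one (K := F.K)) a χ))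

/-! ## §2 «#20a-CAN» -/

set_option synthInstance.maxHeartbeats 400000 in
set_option maxHeartbeats 16000000 in
/-- **«#20a-CAN»: the #20a letter `Capture.sig_K2E2CapArchPairHolCot` for every frame with `(InfinitePlace.mk ι).embedding = ι`** (the #20a bytes with that one
hypothesis inserted after `2 ≤ [L⁺:ℚ] →`).  Proof: ★ H2 to the packaged frame, the engine's preamble, §1 (see the module docstring).
[cite: Liu2021, App. D §D.1 Steps 1–3, Lem. D.2 (2); proof of Prop. 4.13 «Conversely» (l. 2145–2149); Def. 4.12] [cite: GelbartRogawski1991, §3.1 Prop. 3.1.1 p. 455; Remark p. 457 L4–13]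
[cite: KonnoKonno2007, Thm 5.4] [cite: BorelJacquet1979, §4.1, §4.2] [cite: Weil1964, Chap. III n° 41] -/
theorem capArchPairHolCot_canonical :
      ∀ (L : Type) [Field L] [NumberField L] [IsCMField L] (ι : L →+* ℂ) (H : Matrix (Fin 3) (Fin 3) L) (T : GL (Fin 3) ℂ)
        (hT : (T : Matrix (Fin 3) (Fin 3) ℂ)ᴴ * H.map ι * (T : Matrix (Fin 3) (Fin 3) ℂ) = Literature.Geometry.ComplexHyperbolic.BallModel.J),
        (∀ τ' : L →+* ℂ, InfinitePlace.mk τ' ≠ InfinitePlace.mk ι → (H.map τ').PosDef) → 2 ≤ Module.finrank ℚ ↥(maximalRealSubfield L) →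
        (InfinitePlace.mk ι).embedding = ι →
        ∀ {n' : ℕ} (e₁ : Fin 3 × Fin 1 ≃ Fin n') (dV : Fin 3 → L) (hdV : ∀ i, IsCMField.complexConj L (dV i) = dV i)
          (hdV0 : ∀ i, dV i ≠ 0) (g : GL (Fin 3) L)
          (hg : ((g : Matrix (Fin 3) (Fin 3) L).map (cmConjRingHom L))ᵀ * H * (g : Matrix (Fin 3) (Fin 3) L) = Matrix.diagonal dV)
          (ιV : finAdelic (↥(maximalRealSubfield L)) L (IsCMField.complexConj L) 3 H →*
              finAdelic (↥(maximalRealSubfield L)) L (IsCMField.complexConj L) 3 (Matrix.diagonal dV)),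
            (∀ k, ((ιV k : finAdelic (↥(maximalRealSubfield L)) L (IsCMField.complexConj L) 3 (Matrix.diagonal dV)) :
                GL (Fin 3) (FiniteAdeleRing (𝓞 L) L)) =
              (toFinAdeleGL L 3 g)⁻¹ * (k : GL (Fin 3) (FiniteAdeleRing (𝓞 L) L)) * toFinAdeleGL L 3 g) →
          ∀ [CompactSpace (↥(UnitaryGroup.adelic (↥(maximalRealSubfield L)) L (IsCMField.complexConj L) 3 (Matrix.diagonal dV)) ⧸
              (UnitaryGroup.toAdelic (↥(maximalRealSubfield L)) L (IsCMField.complexConj L) 3 (Matrix.diagonal dV)).range)],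
          ∀ (μ : Literature.NumberTheory.Automorphic.IdeleClassGroup L →ₜ* Circle) (hμ : IsConjugateSymplectic L μ), HasWeight L μ 1 →
            ι ∈ hμ.cmType.1 →
          ∀ (a : (↥(maximalRealSubfield L))ˣ) (χ : Chi (↥(maximalRealSubfield L)) L (IsCMField.complexConj L)),
              IsAdmissibleElement L hμ.cmType.1 (algebraMap (↥(maximalRealSubfield L)) L a * (2 * imagUnit L)⁻¹) →
              ∀ (hρ : HasThetaMajorants fun
                  (p : ↥(UnitaryGroup.adelic (↥(maximalRealSubfield L)) L (IsCMField.complexConj L) 3 (Matrix.diagonal dV)) ×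
                    ↥(UnitaryGroup.adelic (↥(maximalRealSubfield L)) L (IsCMField.complexConj L) 1 (JW (↥(maximalRealSubfield L)) L a)))
                  (Φ : piSchwartzBruhat (↥(maximalRealSubfield L)) (Fin n')) =>
                    pairRep (↥(maximalRealSubfield L)) L (IsCMField.complexConj L) 3 1 e₁ (Matrix.diagonal dV) (JW (↥(maximalRealSubfield L)) L a)
                      (chiSplittingLine L e₁ dV hdV hdV0 (toHeckeCharacter L μ) (isUnitary_toHeckeCharacter L μ)
                        ((isOscillatorChar_toHeckeCharacter_iff μ).mpr hμ) (TW (↥(maximalRealSubfield L)) a)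
                        (isUnit_det_TW (↥(maximalRealSubfield L)) a) (JW (↥(maximalRealSubfield L)) L a) (JW_eq (↥(maximalRealSubfield L)) L a))
                      p Φ)
                [MeasurableSpace (↥(UnitaryGroup.adelic (↥(maximalRealSubfield L)) L (IsCMField.complexConj L) 1
                    (JW (↥(maximalRealSubfield L)) L a)) ⧸
                      (UnitaryGroup.toAdelic (↥(maximalRealSubfield L)) L (IsCMField.complexConj L) 1 (JW (↥(maximalRealSubfield L)) L a)).range)]
                [BorelSpace (↥(UnitaryGroup.adelic (↥(maximalRealSubfield L)) L (IsCMField.complexConj L) 1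
                    (JW (↥(maximalRealSubfield L)) L a)) ⧸
                      (UnitaryGroup.toAdelic (↥(maximalRealSubfield L)) L (IsCMField.complexConj L) 1 (JW (↥(maximalRealSubfield L)) L a)).range)]
                (μW : Measure (↥(UnitaryGroup.adelic (↥(maximalRealSubfield L)) L (IsCMField.complexConj L) 1
                  (JW (↥(maximalRealSubfield L)) L a)) ⧸
                    (UnitaryGroup.toAdelic (↥(maximalRealSubfield L)) L (IsCMField.complexConj L) 1 (JW (↥(maximalRealSubfield L)) L a)).range))
                [IsFiniteMeasure μW]
                [SMulInvariantMeasure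
                  (↥(UnitaryGroup.adelic (↥(maximalRealSubfield L)) L (IsCMField.complexConj L) 1 (JW (↥(maximalRealSubfield L)) L a)))
                  (↥(UnitaryGroup.adelic (↥(maximalRealSubfield L)) L (IsCMField.complexConj L) 1 (JW (↥(maximalRealSubfield L)) L a)) ⧸
                    (UnitaryGroup.toAdelic (↥(maximalRealSubfield L)) L (IsCMField.complexConj L) 1 (JW (↥(maximalRealSubfield L)) L a)).range)
                  μW]
                [μW.IsOpenPosMeasure],
              ∃ (φ : Fin 2 → 𝓢(((Fin 3 × Fin 1) → NumberField.mixedEmbedding.mixedSpace ↥(maximalRealSubfield L)), ℂ)) (j₀ : Fin 2),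
                  -- (HOLCOT) every theta pair of `φ` read on `U(H)(𝔸)` along the canonical transport is a HOLOMORPHIC COTANGENT FORM at `(ι, T)` …
                (haveI := normal_range_toAdelic_JW L a
                 ∀ (Φf : FinSB (↥(maximalRealSubfield L)) (Fin 3 × Fin 1)),
                    ((fun (x : (adelicGroupData (↥(maximalRealSubfield L)) L (IsCMField.complexConj L) 3 H).Adelic) (j : Fin 2) =>
                      (lineThetaKernelDatum L 3 e₁ dV hdV hdV0 μ hμ a hρ).thetaLiftFun μW
                        (piSBReindex (↥(maximalRealSubfield L)) e₁
                          (piSchwartzBruhatEquiv (↥(maximalRealSubfield L)) (Fin 3 × Fin 1) (φ j ⊗ₜ[ℂ] Φf)))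
                        (charCM (chiQuot (↥(maximalRealSubfield L)) L (IsCMField.complexConj L) (Algebra.IsQuadraticExtension.finrank_eq_two _ L)
                          (IsCMField.complexConj_ne_one (K := L)) a χ))
                        ((cmAdelicFrameTransport L 3 H dV g hg) x))) ∈
                      CotangentForms.holCotForms (↥(maximalRealSubfield L)) L (IsCMField.complexConj L) 3 H
                        (cmArchSection L ι H T hT) (cmCompactFactor L ι H T hT)) ∧
                  -- … the archimedean vector `R^∞_{e₁} φ_{j₀}` is non-zero …
                schwartzReindexCLM (↥(maximalRealSubfield L)) e₁ (φ j₀) ≠ 0 ∧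
                  -- (E) … and FIXED by `U(⟨a⟩)(L⁺ ⊗ ℝ)` under the archimedean Weil representation at the `μ`-splitting
                (∀ a' : UnitaryGroup.arch (↥(maximalRealSubfield L)) L (IsCMField.complexConj L) 1 (JW (↥(maximalRealSubfield L)) L a),
                  HodgeCM.Model.HypCensus.archWeilRep (↥(maximalRealSubfield L)) L (IsCMField.complexConj L) 3 1 (Matrix.diagonal dV)
                    (JW (↥(maximalRealSubfield L)) L a) (complexConj_imagUnit L) (imagUnit_ne_zero L) (imagUnit_mul_self L) (realDiagonal_isSymm L dV hdV)
                    (isSymm_TW (↥(maximalRealSubfield L)) a) (isUnit_det_realDiagonal L dV hdV hdV0) (isUnit_det_TW (↥(maximalRealSubfield L)) a)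
                    (realDiagonal_map L dV hdV).symm (JW_eq (↥(maximalRealSubfield L)) L a) e₁
                    (chiSplittingLine L e₁ dV hdV hdV0 (toHeckeCharacter L μ) (isUnitary_toHeckeCharacter L μ)
                      ((isOscillatorChar_toHeckeCharacter_iff μ).mpr hμ) (TW (↥(maximalRealSubfield L)) a)
                      (isUnit_det_TW (↥(maximalRealSubfield L)) a) (JW (↥(maximalRealSubfield L)) L a) (JW_eq (↥(maximalRealSubfield L)) L a))
                    (ThetaNonvanishing.proj_apply_eq_toSp (↥(maximalRealSubfield L)) L (IsCMField.complexConj L) 3 1 e₁ (Matrix.diagonal dV)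
                      (JW (↥(maximalRealSubfield L)) L a) (complexConj_imagUnit L) (imagUnit_ne_zero L) (imagUnit_mul_self L) (realDiagonal_isSymm L dV hdV)
                      (isSymm_TW (↥(maximalRealSubfield L)) a) (isUnit_det_realDiagonal L dV hdV hdV0) (isUnit_det_TW (↥(maximalRealSubfield L)) a)
                      (realDiagonal_map L dV hdV).symm (JW_eq (↥(maximalRealSubfield L)) L a)
                      (isCompatible_chiSplittingLine L e₁ dV hdV hdV0 (toHeckeCharacter L μ) (isUnitary_toHeckeCharacter L μ)
                        ((isOscillatorChar_toHeckeCharacter_iff μ).mpr hμ) (TW (↥(maximalRealSubfield L)) a) (isSymm_TW (↥(maximalRealSubfield L)) a)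
                        (isUnit_det_TW (↥(maximalRealSubfield L)) a) (JW (↥(maximalRealSubfield L)) L a) (JW_eq (↥(maximalRealSubfield L)) L a)))
                    (1, a') (schwartzReindexCLM (↥(maximalRealSubfield L)) e₁ (φ j₀)) = schwartzReindexCLM (↥(maximalRealSubfield L)) e₁ (φ j₀)) := by
  intro L _ _ _ ι H T hT hpos h2 hemb
  refine K2E2CapArchPairFrameTransport.capArchPairHolCot_frameTransport L ι H T hT hpos h2 HodgeCM.Model.ArchSideTerm.e₁
    (frameD (hermSpace3Of L ι H T hT hpos)) (frameD_real (hermSpace3Of L ι H T hT hpos)) (frameD_ne (hermSpace3Of L ι H T hT hpos))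
    (frameG (hermSpace3Of L ι H T hT hpos)) (frame_congr (hermSpace3Of L ι H T hT hpos)) ?_
  intro _ _ _ μ hμ hw hι a χ he hρ _ _ μW _ _ _
  exact capArchPairHolCot_packaged (cmFieldOf L) (hermSpace3Of L ι H T hT hpos) h2 hemb T hT μ hμ hw hι a χ he hρ μW

end Summit.HodgeConjecture.HodgeConjecture.Cruxes.H413.K2E2CapArchPairHolCotCanonical

end
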